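import Literature.Analysis.OperatorTheory.RieszProjectionIdempotent
import Literature.Analysis.OperatorTheory.RieszProjectionDichotomy
import Literature.Analysis.OperatorTheory.RieszProjectionEigenbasis
import HarnessLib

/-!
# Nested Riesz projections and the spectral projection of an annulus (Kato III-§6.4, Thm. 6.17
  for a spectrum separated into several parts)

Analysis/OperatorTheory proofs-layer file (theorems only, no definitions, no named facts),
continuing `RieszProjectionIdempotent.lean` (`P² = P`, `aP = Pa`), `RieszProjectionDichotomy.lean`
(`‖aⁿ P_r‖ ≤ r M rⁿ` for circles around the origin) and `RieszProjectionEigenbasis.lean` (rank of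
`P` in an orthonormal eigenbasis). Kato's Theorem III-6.17 separates the spectrum by ONE closed
curve; the remark following it ("a finite number of parts `Σ₁, …, Σ_s` … projections `P_h` with
`P_h P_k = δ_{hk} P_h`, `Σ P_h = 1`", III-§6.4 (6.24)–(6.26), and III-§6.5 for isolated
eigenvalues) is what transfer-operator arguments with SEVERAL dominant eigenvalues need. With
circles only (Mathlib's Cauchy theory is for discs and concentric annuli) the several parts are
separated by CONCENTRIC circles `C(c, r₀), C(c, r₁), …` about a common centre `c`, and the
projection of the part of the spectrum in the open annulus `r < |z − c| < r'` is the difference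
`P_{r'} − P_r` of two Riesz projections (`P_ρ = rieszProjection a c ρ`). We prove:

* `circleIntegral_resolvent_mul_circleIntegral_of_lt` — Riesz's double-contour computation
  `(∮_{C(c,r)} R)(∮_{C(c,r')} R) = 2πi ∮_{C(c,r)} R` for `r < r'` assuming ONLY that the two
  circles lie in the resolvent set (the tree's `circleIntegral_resolvent_mul_circleIntegral` asks
  for the whole closed annulus; its proof never uses that, and spectrum inside the annulus is
  exactly the case of interest here); `circleIntegral_resolvent_comm_circleIntegral` — the two
  Riesz integrals commute;
* **nesting** `rieszProjection_mul_rieszProjection_of_le` / `_of_le'`: `P_r P_{r'} = P_{r'} P_r = P_r`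
  for `r ≤ r'` (Kato (6.25): `P_h P_k = δ_{hk} P_h` in the nested form);
* **the annulus projection** `Q = P_{r'} − P_r`: `sub_rieszProjection_mul_self` (`Q² = Q`),
  `sub_rieszProjection_mul_rieszProjection` / `rieszProjection_mul_sub_rieszProjection`
  (`Q P_r = P_r Q = 0`), `sub_rieszProjection_mul_sub_rieszProjection_eq_zero` (projections of
  disjoint annuli annihilate each other), `one_sub_rieszProjection_mul_sub_rieszProjection`
  (`(1 − P_{r'}) Q = 0`), `commute_sub_rieszProjection` (`aQ = Qa`);
* **powers on the inner part for a general centre**: `pow_mul_circleIntegral_resolvent_of_center`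
  (`aⁿ ∮_{C(c,r)} R = ∮ zⁿ R`) and `norm_pow_mul_rieszProjection_le_of_center`
  (`‖aⁿ P_{c,r}‖ ≤ r M (‖c‖ + r)ⁿ`), the forward dichotomy estimate III-(6.19) off the origin;
* `eq_zero_of_mul_self_eq_of_norm_lt_one` — an idempotent of norm `< 1` vanishes (so along a
  norm-continuous family a complementary projection which is `0` at one point stays `0`);
* for operators: `sub_rieszProjection_apply_of_mem_annulus` (`Q v = v` for an eigenvector with
  eigenvalue in the open annulus), `sub_rieszProjection_apply_of_mem_ball` /
  `sub_rieszProjection_apply_of_not_mem_closedBall` (`Q v = 0` otherwise),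
  `eq_of_mul_sub_rieszProjection_eq_smul` (a scalar `μ` with `T Q = μ Q` IS that eigenvalue), and
  in an orthonormal eigenbasis `sub_rieszProjection_apply_eq_sum`,
  **`finrank_range_sub_rieszProjection_eq_card`** / `_eq_one` (`dim Ran Q` = number of
  eigenvalues in the annulus) — the rank hypothesis of `TwoDominantEigenvalues.lean` made checkable.

## Mathlib / tree search

Tree: `rieszProjection_mul_self`, `commute_rieszProjection`, `resolvent_mul_resolvent`,
`resolvent_mul_comm`, `mul_circleIntegral`, `mul_resolvent_eq_smul_sub_one`,
`pow_mul_circleIntegral_resolvent` (centre `0` only), `norm_pow_mul_rieszProjection_le` (centre `0`),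
`exists_backward_family` (uses `P_ρ − P_r` but proves no projection algebra for it),
`rieszProjection_apply_of_apply_eq_smul{_of_not_mem}`, `clm_apply_eq_sum_of_apply_hilbertBasis`,
`finrank_range_eq_card_of_apply_hilbertBasis`. Searched `rieszProjection_mul_rieszProjection`,
`sub_rieszProjection`, `annulus.*[Pp]rojection` — none.

## References

* T. Kato, *Perturbation Theory for Linear Operators*, Springer 1966, III-§6.4, Thm. 6.17 and
  (6.19)–(6.26) (held copy `book:kato1966-perturbation-theory-linear-operators`, chunk p0221),
  III-§6.5, I-§5.3 (5.17). [Kato1966]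
-/

noncomputable section

open Complex MeasureTheory Metric Set Filter Topology
open scoped InnerProductSpace NNReal

namespace Literature.Analysis.OperatorTheory

/-! ### Riesz integrals over two concentric circles -/

section BanachAlgebra

variable {A : Type*} [NormedRing A] [NormedAlgebra ℂ A] [CompleteSpace A]

/-- Right multiplication commutes with the circle integral (companion of the tree's
`mul_circleIntegral`). [folklore] -/
theorem circleIntegral_mul {f : ℂ → A} {c : ℂ} {R : ℝ} (hf : CircleIntegrable f c R) (a : A) :
    (∮ z in C(c, R), f z) * a = ∮ z in C(c, R), f z * a := by
  have hl := ((ContinuousLinearMap.mul ℂ A).flip a).intervalIntegral_comp_comm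
    ((circleIntegrable_iff R).1 hf)
  simp only [ContinuousLinearMap.flip_apply, ContinuousLinearMap.mul_apply', smul_mul_assoc] at hl
  simp only [circleIntegral]
  exact hl.symm

/-- **Riesz's double-contour computation for two circles in the resolvent set** (Kato I-(5.17) /
III-(6.19), (6.25)): if `0 < r < r'` and BOTH circles `|z − c| = r`, `|w − c| = r'` lie in the
resolvent set of `a` — no hypothesis on the annulus between them — then
`(∮_{C(c,r)} R(z) dz)(∮_{C(c,r')} R(w) dw) = 2πi ∮_{C(c,r)} R(z) dz`. Proof: by the first
resolvent identity, for `|z − c| = r`,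
`R(z) ∮ R(w) dw = (∮ (w − z)⁻¹ dw) R(z) − ∮ (w − z)⁻¹ R(w) dw = 2πi R(z) − H(z)` with `H` the Cauchy
integral of `R` over `C(c, r')`, holomorphic in `|z − c| < r'`, so `∮_{C(c,r)} H = 0`.
[cite: Kato1966, III-§6.4 Thm. 6.17 (6.19) and (6.25)] -/
theorem circleIntegral_resolvent_mul_circleIntegral_of_lt {a : A} {c : ℂ} {r r' : ℝ} (hr : 0 < r)
    (hrr' : r < r') (hs : sphere c r ⊆ resolventSet ℂ a) (hs' : sphere c r' ⊆ resolventSet ℂ a) :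
    (∮ z in C(c, r), resolvent a z) * (∮ w in C(c, r'), resolvent a w) =
      (2 * Real.pi * I) • ∮ z in C(c, r), resolvent a z := by
  have hr' : 0 < r' := hr.trans hrr'
  have hRc : ContinuousOn (resolvent a) (sphere c r) := (continuousOn_resolvent a).mono hs
  have hRc' : ContinuousOn (resolvent a) (sphere c r') := (continuousOn_resolvent a).mono hs'
  have hRi : CircleIntegrable (resolvent a) c r := hRc.circleIntegrable hr.le
  have hRi' : CircleIntegrable (resolvent a) c r' := hRc'.circleIntegrable hr'.le
  set J : A := ∮ w in C(c, r'), resolvent a w with hJ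
  -- the Cauchy integral of the resolvent over the outer circle
  set H : ℂ → A := fun z => ∮ w in C(c, r'), (w - z)⁻¹ • resolvent a w with hH
  -- (1) pull the constant `J` inside the `z`-integral
  have step1 : (∮ z in C(c, r), resolvent a z) * J = ∮ z in C(c, r), resolvent a z * J :=
    circleIntegral_mul hRi J
  -- (2) pointwise on the inner circle: `R(z) J = 2πi R(z) − H(z)`
  have step2 : ∀ z ∈ sphere c r, resolvent a z * J = (2 * Real.pi * I) • resolvent a z - H z := by
    intro z hz
    have hzρ : z ∈ resolventSet ℂ a := hs hz
    have hzball : z ∈ ball c r' := by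
      rw [mem_ball, mem_sphere.1 hz]; exact hrr'
    have hzw : ∀ w ∈ sphere c r', z ≠ w := fun w hw hzw' => by
      have h1 := mem_sphere.1 hz; rw [hzw', mem_sphere.1 hw] at h1; exact hrr'.ne' h1
    -- `R(z) J = ∮ R(z) R(w) dw`
    have hin : resolvent a z * J = ∮ w in C(c, r'), resolvent a z * resolvent a w :=
      mul_circleIntegral hRi' (resolvent a z)
    -- integrability of the two pieces on the outer circle
    have hci : ContinuousOn (fun w : ℂ => (w - z)⁻¹) (sphere c r') := fun w hw =>
      (continuousAt_id.sub continuousAt_const).inv₀ (sub_ne_zero.2 (Ne.symm (hzw w hw)))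
        |>.continuousWithinAt
    have hi1 : CircleIntegrable (fun w : ℂ => (w - z)⁻¹ • resolvent a z) c r' :=
      (hci.smul continuousOn_const).circleIntegrable hr'.le
    have hi2 : CircleIntegrable (fun w : ℂ => (w - z)⁻¹ • resolvent a w) c r' :=
      (hci.smul hRc').circleIntegrable hr'.le
    rw [hin, circleIntegral.integral_congr hr'.le fun w hw =>
      resolvent_mul_resolvent hzρ (hs' hw) (hzw w hw)]
    simp_rw [smul_sub]
    rw [circleIntegral.integral_sub hi1 hi2, circleIntegral.integral_smul_const,
      circleIntegral.integral_sub_inv_of_mem_ball hzball]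
  -- (3) `H` is holomorphic on the big disc, so `∮_{C(c,r)} H = 0`
  have hHan : DifferentiableOn ℂ H (ball c r') := by
    set R' : ℝ≥0 := ⟨r', hr'.le⟩ with hR'
    have hR'pos : (0 : ℝ≥0) < R' := (NNReal.coe_pos (r := R')).1 hr'
    have hps := hasFPowerSeriesOn_cauchy_integral (f := resolvent a) (c := c) (R := R') hRi' hR'pos
    have hd := hps.differentiableOn
    rw [Metric.eball_coe] at hd
    have hH' : H = fun z => (2 * Real.pi * I) •
        ((2 * Real.pi * I)⁻¹ • ∮ w in C(c, (R' : ℝ)), (w - z)⁻¹ • resolvent a w) := by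
      funext z
      rw [smul_smul, mul_inv_cancel₀ (by simp [Real.pi_ne_zero, I_ne_zero]), one_smul]
      rfl
    rw [hH']
    exact (hd.const_smul (2 * Real.pi * I : ℂ)).congr fun z _ => rfl
  have hH0 : (∮ z in C(c, r), H z) = 0 :=
    circleIntegral_eq_zero_of_differentiable_on_off_countable hr.le countable_empty
      (hHan.continuousOn.mono (closedBall_subset_ball hrr'))
      fun z hz => hHan.differentiableAt (isOpen_ball.mem_nhds (ball_subset_ball hrr'.le hz.1))
  -- (4) assemble
  have hiA : CircleIntegrable (fun z => (2 * Real.pi * I) • resolvent a z) c r := by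
    have := (continuousOn_const.smul hRc : ContinuousOn (fun z => (2 * Real.pi * I : ℂ) •
      resolvent a z) (sphere c r))
    exact this.circleIntegrable hr.le
  have hiH : CircleIntegrable H c r :=
    (hHan.continuousOn.mono (sphere_subset_closedBall.trans (closedBall_subset_ball hrr'))).circleIntegrable
      hr.le
  rw [step1, circleIntegral.integral_congr hr.le step2, circleIntegral.integral_sub hiA hiH, hH0,
    sub_zero, circleIntegral.integral_smul]

/-- The resolvent at a point of the resolvent set commutes with every Riesz integral of the same
element (the resolvents at two points commute, Kato I-(5.6)). [cite: Kato1966, I-§5.2 (5.5)–(5.6)] -/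
theorem resolvent_mul_circleIntegral_resolvent_comm {a : A} {z c : ℂ} {R : ℝ} (hR : 0 ≤ R)
    (hz : z ∈ resolventSet ℂ a) (hs : sphere c R ⊆ resolventSet ℂ a) :
    resolvent a z * (∮ w in C(c, R), resolvent a w) =
      (∮ w in C(c, R), resolvent a w) * resolvent a z := by
  have hRi : CircleIntegrable (resolvent a) c R :=
    ((continuousOn_resolvent a).mono hs).circleIntegrable hR
  rw [mul_circleIntegral hRi, circleIntegral_mul hRi]
  exact circleIntegral.integral_congr hR fun w hw => resolvent_mul_comm hz (hs hw)

/-- **Two Riesz integrals of the same element commute.** [cite: Kato1966, III-§6.4 (6.25)] -/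
theorem circleIntegral_resolvent_comm_circleIntegral {a : A} {c c' : ℂ} {r r' : ℝ} (hr : 0 ≤ r)
    (hr' : 0 ≤ r') (hs : sphere c r ⊆ resolventSet ℂ a) (hs' : sphere c' r' ⊆ resolventSet ℂ a) :
    (∮ z in C(c, r), resolvent a z) * (∮ w in C(c', r'), resolvent a w) =
      (∮ w in C(c', r'), resolvent a w) * ∮ z in C(c, r), resolvent a z := by
  have hRi : CircleIntegrable (resolvent a) c r :=
    ((continuousOn_resolvent a).mono hs).circleIntegrable hr
  rw [circleIntegral_mul hRi, mul_circleIntegral hRi]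
  exact circleIntegral.integral_congr hr fun z hz =>
    resolvent_mul_circleIntegral_resolvent_comm hr' (hs hz) hs'

/-- The double-contour computation in the other order:
`(∮_{C(c,r')} R)(∮_{C(c,r)} R) = 2πi ∮_{C(c,r)} R` for `r < r'`. [cite: Kato1966, III-§6.4 Thm. 6.17 (6.19) and (6.25)] -/
theorem circleIntegral_resolvent_mul_circleIntegral_of_lt' {a : A} {c : ℂ} {r r' : ℝ} (hr : 0 < r)
    (hrr' : r < r') (hs : sphere c r ⊆ resolventSet ℂ a) (hs' : sphere c r' ⊆ resolventSet ℂ a) :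
    (∮ w in C(c, r'), resolvent a w) * (∮ z in C(c, r), resolvent a z) =
      (2 * Real.pi * I) • ∮ z in C(c, r), resolvent a z := by
  rw [← circleIntegral_resolvent_comm_circleIntegral hr.le (hr.trans hrr').le hs hs',
    circleIntegral_resolvent_mul_circleIntegral_of_lt hr hrr' hs hs']

/-! ### Nesting of concentric Riesz projections -/

/-- **Nesting, `P_r P_{r'} = P_r` for `r < r'`** (both circles in the resolvent set; the spectrum
may meet the annulus): Kato's `P_h P_k = δ_{hk} P_h` (III-(6.25)) for the nested family of discs.
[cite: Kato1966, III-§6.4 Thm. 6.17 (6.19) and (6.25)] -/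
theorem rieszProjection_mul_rieszProjection_of_lt {a : A} {c : ℂ} {r r' : ℝ} (hr : 0 < r)
    (hrr' : r < r') (hs : sphere c r ⊆ resolventSet ℂ a) (hs' : sphere c r' ⊆ resolventSet ℂ a) :
    rieszProjection a c r * rieszProjection a c r' = rieszProjection a c r := by
  have h2 : (2 * Real.pi * I : ℂ) ≠ 0 := by simp [Real.pi_ne_zero, I_ne_zero]
  rw [rieszProjection_def, rieszProjection_def, smul_mul_smul_comm,
    circleIntegral_resolvent_mul_circleIntegral_of_lt hr hrr' hs hs', smul_smul, mul_assoc,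
    inv_mul_cancel₀ h2, mul_one]

/-- **Nesting in the other order, `P_{r'} P_r = P_r` for `r < r'`.** [cite: Kato1966, III-§6.4 Thm. 6.17 (6.19) and (6.25)] -/
theorem rieszProjection_mul_rieszProjection_of_lt' {a : A} {c : ℂ} {r r' : ℝ} (hr : 0 < r)
    (hrr' : r < r') (hs : sphere c r ⊆ resolventSet ℂ a) (hs' : sphere c r' ⊆ resolventSet ℂ a) :
    rieszProjection a c r' * rieszProjection a c r = rieszProjection a c r := by
  have h2 : (2 * Real.pi * I : ℂ) ≠ 0 := by simp [Real.pi_ne_zero, I_ne_zero]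
  rw [rieszProjection_def, rieszProjection_def, smul_mul_smul_comm,
    circleIntegral_resolvent_mul_circleIntegral_of_lt' hr hrr' hs hs', smul_smul, mul_assoc,
    inv_mul_cancel₀ h2, mul_one]

/-- `P_r P_{r'} = P_r` for `r ≤ r'`. [cite: Kato1966, III-§6.4 Thm. 6.17 (6.19) and (6.25)] -/
theorem rieszProjection_mul_rieszProjection_of_le {a : A} {c : ℂ} {r r' : ℝ} (hr : 0 < r)
    (hrr' : r ≤ r') (hs : sphere c r ⊆ resolventSet ℂ a) (hs' : sphere c r' ⊆ resolventSet ℂ a) :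
    rieszProjection a c r * rieszProjection a c r' = rieszProjection a c r := by
  rcases hrr'.lt_or_eq with hlt | heq
  · exact rieszProjection_mul_rieszProjection_of_lt hr hlt hs hs'
  · subst heq; exact rieszProjection_mul_self hr hs

/-- `P_{r'} P_r = P_r` for `r ≤ r'`. [cite: Kato1966, III-§6.4 Thm. 6.17 (6.19) and (6.25)] -/
theorem rieszProjection_mul_rieszProjection_of_le' {a : A} {c : ℂ} {r r' : ℝ} (hr : 0 < r)
    (hrr' : r ≤ r') (hs : sphere c r ⊆ resolventSet ℂ a) (hs' : sphere c r' ⊆ resolventSet ℂ a) :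
    rieszProjection a c r' * rieszProjection a c r = rieszProjection a c r := by
  rcases hrr'.lt_or_eq with hlt | heq
  · exact rieszProjection_mul_rieszProjection_of_lt' hr hlt hs hs'
  · subst heq; exact rieszProjection_mul_self hr hs

/-- Two concentric Riesz projections commute. [cite: Kato1966, III-§6.4 (6.25)] -/
theorem commute_rieszProjection_rieszProjection {a : A} {c : ℂ} {r r' : ℝ} (hr : 0 < r)
    (hr' : 0 < r') (hs : sphere c r ⊆ resolventSet ℂ a) (hs' : sphere c r' ⊆ resolventSet ℂ a) :
    Commute (rieszProjection a c r) (rieszProjection a c r') := by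
  rcases le_total r r' with h | h
  · unfold Commute SemiconjBy
    rw [rieszProjection_mul_rieszProjection_of_le hr h hs hs',
      rieszProjection_mul_rieszProjection_of_le' hr h hs hs']
  · unfold Commute SemiconjBy
    rw [rieszProjection_mul_rieszProjection_of_le' hr' h hs' hs,
      rieszProjection_mul_rieszProjection_of_le hr' h hs' hs]

/-! ### The spectral projection of an annulus `Q = P_{r'} − P_r` -/

/-- **The annulus projection is an idempotent**: `(P_{r'} − P_r)² = P_{r'} − P_r` for `r ≤ r'`
(Kato III-(6.24)–(6.26): the projection on the part of the spectrum in `r < |z − c| < r'`).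
[cite: Kato1966, III-§6.4 Thm. 6.17 (6.24)–(6.26)] -/
theorem sub_rieszProjection_mul_self {a : A} {c : ℂ} {r r' : ℝ} (hr : 0 < r) (hrr' : r ≤ r')
    (hs : sphere c r ⊆ resolventSet ℂ a) (hs' : sphere c r' ⊆ resolventSet ℂ a) :
    (rieszProjection a c r' - rieszProjection a c r) * (rieszProjection a c r' - rieszProjection a c r) =
      rieszProjection a c r' - rieszProjection a c r := by
  rw [sub_mul, mul_sub, mul_sub, rieszProjection_mul_self (hr.trans_le hrr') hs',
    rieszProjection_mul_rieszProjection_of_le' hr hrr' hs hs',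
    rieszProjection_mul_rieszProjection_of_le hr hrr' hs hs', rieszProjection_mul_self hr hs,
    sub_self, sub_zero]

/-- `(P_{r'} − P_r) P_r = 0`: the annulus projection kills the inner part. [cite: Kato1966, III-§6.4 (6.25)] -/
theorem sub_rieszProjection_mul_rieszProjection {a : A} {c : ℂ} {r r' : ℝ} (hr : 0 < r)
    (hrr' : r ≤ r') (hs : sphere c r ⊆ resolventSet ℂ a) (hs' : sphere c r' ⊆ resolventSet ℂ a) :
    (rieszProjection a c r' - rieszProjection a c r) * rieszProjection a c r = 0 := by
  rw [sub_mul, rieszProjection_mul_rieszProjection_of_le' hr hrr' hs hs',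
    rieszProjection_mul_self hr hs, sub_self]

/-- `P_r (P_{r'} − P_r) = 0`. [cite: Kato1966, III-§6.4 (6.25)] -/
theorem rieszProjection_mul_sub_rieszProjection {a : A} {c : ℂ} {r r' : ℝ} (hr : 0 < r)
    (hrr' : r ≤ r') (hs : sphere c r ⊆ resolventSet ℂ a) (hs' : sphere c r' ⊆ resolventSet ℂ a) :
    rieszProjection a c r * (rieszProjection a c r' - rieszProjection a c r) = 0 := by
  rw [mul_sub, rieszProjection_mul_rieszProjection_of_le hr hrr' hs hs',
    rieszProjection_mul_self hr hs, sub_self]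

/-- `(1 − P_{r'}) (P_{r'} − P_r) = 0`: the projection on the outer part kills the annulus part.
[cite: Kato1966, III-§6.4 (6.25)] -/
theorem one_sub_rieszProjection_mul_sub_rieszProjection {a : A} {c : ℂ} {r r' : ℝ} (hr : 0 < r)
    (hrr' : r ≤ r') (hs : sphere c r ⊆ resolventSet ℂ a) (hs' : sphere c r' ⊆ resolventSet ℂ a) :
    (1 - rieszProjection a c r') * (rieszProjection a c r' - rieszProjection a c r) = 0 := by
  rw [sub_mul, one_mul, mul_sub, rieszProjection_mul_self (hr.trans_le hrr') hs',
    rieszProjection_mul_rieszProjection_of_le' hr hrr' hs hs', sub_self]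

/-- `(P_{r'} − P_r) (1 − P_{r'}) = 0`. [cite: Kato1966, III-§6.4 (6.25)] -/
theorem sub_rieszProjection_mul_one_sub_rieszProjection {a : A} {c : ℂ} {r r' : ℝ} (hr : 0 < r)
    (hrr' : r ≤ r') (hs : sphere c r ⊆ resolventSet ℂ a) (hs' : sphere c r' ⊆ resolventSet ℂ a) :
    (rieszProjection a c r' - rieszProjection a c r) * (1 - rieszProjection a c r') = 0 := by
  rw [mul_sub, mul_one, sub_mul, rieszProjection_mul_self (hr.trans_le hrr') hs',
    rieszProjection_mul_rieszProjection_of_le hr hrr' hs hs', sub_self]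

/-- `(1 − P_r) P_r = 0`. [cite: Kato1966, III-§6.4 Thm. 6.17 (6.19)] -/
theorem one_sub_rieszProjection_mul_rieszProjection {a : A} {c : ℂ} {r : ℝ} (hr : 0 < r)
    (hs : sphere c r ⊆ resolventSet ℂ a) :
    (1 - rieszProjection a c r) * rieszProjection a c r = 0 := by
  rw [sub_mul, one_mul, rieszProjection_mul_self hr hs, sub_self]

/-- `(1 − P_r)² = 1 − P_r`. [cite: Kato1966, III-§6.4 Thm. 6.17 (6.19)] -/
theorem one_sub_rieszProjection_mul_self {a : A} {c : ℂ} {r : ℝ} (hr : 0 < r)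
    (hs : sphere c r ⊆ resolventSet ℂ a) :
    (1 - rieszProjection a c r) * (1 - rieszProjection a c r) = 1 - rieszProjection a c r := by
  rw [mul_sub, mul_one, sub_mul, one_mul, rieszProjection_mul_self hr hs, sub_self, sub_zero]

/-- **Projections of disjoint annuli annihilate each other**: for `r₁ ≤ r₂ ≤ r₃ ≤ r₄`,
`(P_{r₂} − P_{r₁})(P_{r₄} − P_{r₃}) = 0`. [cite: Kato1966, III-§6.4 (6.25)] -/
theorem sub_rieszProjection_mul_sub_rieszProjection_eq_zero {a : A} {c : ℂ} {r₁ r₂ r₃ r₄ : ℝ}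
    (hr₁ : 0 < r₁) (h₁₂ : r₁ ≤ r₂) (h₂₃ : r₂ ≤ r₃) (h₃₄ : r₃ ≤ r₄)
    (hs₁ : sphere c r₁ ⊆ resolventSet ℂ a) (hs₂ : sphere c r₂ ⊆ resolventSet ℂ a)
    (hs₃ : sphere c r₃ ⊆ resolventSet ℂ a) (hs₄ : sphere c r₄ ⊆ resolventSet ℂ a) :
    (rieszProjection a c r₂ - rieszProjection a c r₁) * (rieszProjection a c r₄ - rieszProjection a c r₃) =
      0 := by
  have hr₂ : 0 < r₂ := hr₁.trans_le h₁₂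
  rw [sub_mul, mul_sub, mul_sub,
    rieszProjection_mul_rieszProjection_of_le hr₂ (h₂₃.trans h₃₄) hs₂ hs₄,
    rieszProjection_mul_rieszProjection_of_le hr₂ h₂₃ hs₂ hs₃,
    rieszProjection_mul_rieszProjection_of_le hr₁ (h₁₂.trans (h₂₃.trans h₃₄)) hs₁ hs₄,
    rieszProjection_mul_rieszProjection_of_le hr₁ (h₁₂.trans h₂₃) hs₁ hs₃, sub_self, sub_self,
    sub_self]

/-- The same in the other order: `(P_{r₄} − P_{r₃})(P_{r₂} − P_{r₁}) = 0` for
`r₁ ≤ r₂ ≤ r₃ ≤ r₄`. [cite: Kato1966, III-§6.4 (6.25)] -/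
theorem sub_rieszProjection_mul_sub_rieszProjection_eq_zero' {a : A} {c : ℂ} {r₁ r₂ r₃ r₄ : ℝ}
    (hr₁ : 0 < r₁) (h₁₂ : r₁ ≤ r₂) (h₂₃ : r₂ ≤ r₃) (h₃₄ : r₃ ≤ r₄)
    (hs₁ : sphere c r₁ ⊆ resolventSet ℂ a) (hs₂ : sphere c r₂ ⊆ resolventSet ℂ a)
    (hs₃ : sphere c r₃ ⊆ resolventSet ℂ a) (hs₄ : sphere c r₄ ⊆ resolventSet ℂ a) :
    (rieszProjection a c r₄ - rieszProjection a c r₃) * (rieszProjection a c r₂ - rieszProjection a c r₁) =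
      0 := by
  have hr₂ : 0 < r₂ := hr₁.trans_le h₁₂
  rw [sub_mul, mul_sub, mul_sub,
    rieszProjection_mul_rieszProjection_of_le' hr₂ (h₂₃.trans h₃₄) hs₂ hs₄,
    rieszProjection_mul_rieszProjection_of_le' hr₁ (h₁₂.trans (h₂₃.trans h₃₄)) hs₁ hs₄,
    rieszProjection_mul_rieszProjection_of_le' hr₂ h₂₃ hs₂ hs₃,
    rieszProjection_mul_rieszProjection_of_le' hr₁ (h₁₂.trans h₂₃) hs₁ hs₃, sub_self]

/-- The annulus projection commutes with the element. [cite: Kato1966, III-§6.4 Thm. 6.17 (6.20)] -/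
theorem commute_sub_rieszProjection {a : A} {c : ℂ} {r r' : ℝ} (hr : 0 ≤ r) (hr' : 0 ≤ r')
    (hs : sphere c r ⊆ resolventSet ℂ a) (hs' : sphere c r' ⊆ resolventSet ℂ a) :
    Commute a (rieszProjection a c r' - rieszProjection a c r) :=
  (commute_rieszProjection hr' hs').sub_right (commute_rieszProjection hr hs)

/-- The complementary projection commutes with the element. [cite: Kato1966, III-§6.4 Thm. 6.17 (6.20)] -/
theorem commute_one_sub_rieszProjection {a : A} {c : ℂ} {r : ℝ} (hr : 0 ≤ r)
    (hs : sphere c r ⊆ resolventSet ℂ a) : Commute a (1 - rieszProjection a c r) :=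
  (Commute.one_right a).sub_right (commute_rieszProjection hr hs)

omit [CompleteSpace A] in
/-- **The decomposition of the identity** along `P_r`, the annulus `P_{r'} − P_r` and the outer
part `1 − P_{r'}` (Kato III-(6.25): `Σ P_h = 1`). [cite: Kato1966, III-§6.4 (6.25)] -/
theorem rieszProjection_add_sub_add_one_sub (a : A) (c : ℂ) (r r' : ℝ) :
    rieszProjection a c r + (rieszProjection a c r' - rieszProjection a c r) +
      (1 - rieszProjection a c r') = 1 := by
  abel

/-! ### An idempotent of norm `< 1` vanishes -/

omit [NormedAlgebra ℂ A] [CompleteSpace A] in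
/-- **An idempotent of norm `< 1` is zero** (`‖P‖ = ‖P²‖ ≤ ‖P‖²`). Along a norm-continuous
family of projections this propagates `P = 0` from one parameter value to its neighbours
(Kato I-§4.6 (4.43): `dim P = dim Q` for `‖P − Q‖ < 1`, the case `Q = 0`). [cite: Kato1966, I-§4.6 (4.43)] -/
theorem eq_zero_of_mul_self_eq_of_norm_lt_one {P : A} (hP : P * P = P) (h : ‖P‖ < 1) : P = 0 := by
  by_contra hne
  have hpos : 0 < ‖P‖ := norm_pos_iff.2 hne
  have hle : ‖P‖ ≤ ‖P‖ * ‖P‖ := by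
    calc ‖P‖ = ‖P * P‖ := by rw [hP]
      _ ≤ ‖P‖ * ‖P‖ := norm_mul_le _ _
  have h1 : 1 ≤ ‖P‖ := by
    by_contra hlt
    push Not at hlt
    have := mul_lt_mul_of_pos_left hlt hpos
    rw [mul_one] at this
    exact absurd (hle.trans_lt this) (lt_irrefl _)
  exact absurd (h1.trans_lt h) (lt_irrefl _)

omit [NormedAlgebra ℂ A] [CompleteSpace A] in
/-- Hence an idempotent within distance `< 1` of an idempotent which is `0` is `0` itself — the
form used along continuous families (`Q` the projection at the base point). [cite: Kato1966, I-§4.6 (4.43)] -/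
theorem eq_zero_of_mul_self_eq_of_norm_sub_lt_one {P Q : A} (hP : P * P = P) (hQ : Q = 0)
    (h : ‖P - Q‖ < 1) : P = 0 := by
  subst hQ
  rw [sub_zero] at h
  exact eq_zero_of_mul_self_eq_of_norm_lt_one hP h

/-! ### Powers on the inner part: circles with an arbitrary centre -/

/-- **`aⁿ ∮_{C(c,r)} R(z) dz = ∮_{C(c,r)} zⁿ R(z) dz`** for a circle with ARBITRARY centre in the
resolvent set (induction on `n` with `a R(z) = z R(z) − 1` and `∮ zⁿ dz = 0`, Cauchy's theorem for
the entire function `zⁿ`; the tree's `pow_mul_circleIntegral_resolvent` is the case `c = 0`).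
[cite: Kato1966, III-§6.4 Thm. 6.17 (6.19) and (6.23)] -/
theorem pow_mul_circleIntegral_resolvent_of_center {a : A} {c : ℂ} {r : ℝ} (hr : 0 < r)
    (hs : sphere c r ⊆ resolventSet ℂ a) (n : ℕ) :
    a ^ n * (∮ z in C(c, r), resolvent a z) = ∮ z in C(c, r), z ^ n • resolvent a z := by
  have hRc : ContinuousOn (fun z : ℂ => resolvent a z) (sphere c r) :=
    (continuousOn_resolvent a).mono hs
  induction n with
  | zero => simp
  | succ n ih =>
    have hci : CircleIntegrable (fun z : ℂ => z ^ n • resolvent a z) c r :=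
      ((continuousOn_pow n).smul hRc).circleIntegrable hr.le
    have hci' : CircleIntegrable (fun z : ℂ => z ^ (n + 1) • resolvent a z) c r :=
      ((continuousOn_pow (n + 1)).smul hRc).circleIntegrable hr.le
    have hci1 : CircleIntegrable (fun z : ℂ => z ^ n • (1 : A)) c r :=
      ((continuousOn_pow n).smul continuousOn_const).circleIntegrable hr.le
    rw [pow_succ', mul_assoc, ih, mul_circleIntegral hci]
    have heq : EqOn (fun z : ℂ => a * (z ^ n • resolvent a z))
        (fun z => z ^ (n + 1) • resolvent a z - z ^ n • (1 : A)) (sphere c r) := fun z hz => by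
      simp only
      rw [mul_smul_comm, mul_resolvent_eq_smul_sub_one (hs hz), smul_sub, smul_smul, pow_succ]
    rw [circleIntegral.integral_congr hr.le heq, circleIntegral.integral_sub hci' hci1]
    have h0 : (∮ z in C(c, r), z ^ n • (1 : A)) = 0 :=
      circleIntegral_eq_zero_of_differentiable_on_off_countable hr.le countable_empty
        ((continuousOn_pow n).smul continuousOn_const)
        fun z _ => (differentiableAt_pow n).smul_const (1 : A)
    rw [h0, sub_zero]

/-- On the circle `|z − c| = r` one has `‖z‖ ≤ ‖c‖ + r`. [folklore] -/
theorem norm_le_norm_add_of_mem_sphere {c z : ℂ} {r : ℝ} (hz : z ∈ sphere c r) : ‖z‖ ≤ ‖c‖ + r := by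
  have h := norm_add_le (z - c) c
  rw [sub_add_cancel] at h
  rw [mem_sphere, dist_eq_norm] at hz
  linarith

/-- **Forward dichotomy estimate for an arbitrary centre**: if `|z − c| = r > 0` lies in `ρ(a)`
and `‖R(z)‖ ≤ M` there, then `‖aⁿ P_{c,r}‖ ≤ (r M) (‖c‖ + r)ⁿ` for all `n` — on the range of the
Riesz projection the iterates of `a` grow at most at the rate `‖c‖ + r`, the largest modulus on
the circle (Kato III-(6.19); the tree's `norm_pow_mul_rieszProjection_le` is `c = 0`).
[cite: Kato1966, III-§6.4 Thm. 6.17 (6.19)] -/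
theorem norm_pow_mul_rieszProjection_le_of_center {a : A} {c : ℂ} {r M : ℝ} (hr : 0 < r)
    (hs : sphere c r ⊆ resolventSet ℂ a) (hM : ∀ z ∈ sphere c r, ‖resolvent a z‖ ≤ M) (n : ℕ) :
    ‖a ^ n * rieszProjection a c r‖ ≤ r * M * (‖c‖ + r) ^ n := by
  have hM0 : 0 ≤ M := by
    obtain ⟨z, hz⟩ : (sphere c r).Nonempty := NormedSpace.sphere_nonempty.2 hr.le
    exact (norm_nonneg _).trans (hM z hz)
  have hcr : 0 ≤ ‖c‖ + r := by positivity
  rw [rieszProjection_def, mul_smul_comm, pow_mul_circleIntegral_resolvent_of_center hr hs n]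
  have hb : ∀ z ∈ sphere c r, ‖z ^ n • resolvent a z‖ ≤ (‖c‖ + r) ^ n * M := fun z hz => by
    rw [norm_smul, norm_pow]
    exact mul_le_mul (pow_le_pow_left₀ (norm_nonneg _) (norm_le_norm_add_of_mem_sphere hz) n)
      (hM z hz) (norm_nonneg _) (pow_nonneg hcr n)
  calc ‖(2 * Real.pi * I : ℂ)⁻¹ • ∮ z in C(c, r), z ^ n • resolvent a z‖ ≤ r * ((‖c‖ + r) ^ n * M) :=
        circleIntegral.norm_two_pi_i_inv_smul_integral_le_of_norm_le_const hr.le hb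
    _ = r * M * (‖c‖ + r) ^ n := by ring

end BanachAlgebra

/-! ### Operators: the annulus projection on eigenvectors -/

section Operator

variable {E : Type*} [NormedAddCommGroup E] [NormedSpace ℂ E] [CompleteSpace E]

/-- **`(P_{r'} − P_r) v = v` for an eigenvector with eigenvalue in the open annulus**
`r < |μ − c| < r'` (`P_{r'} v = v`, `P_r v = 0`; Kato III-§6.5). [cite: Kato1966, III-§6.4 Thm. 6.17 (6.19) and III-§6.5] -/
theorem sub_rieszProjection_apply_of_mem_annulus {T : E →L[ℂ] E} {μ : ℂ} {v : E}
    (hv : T v = μ • v) {c : ℂ} {r r' : ℝ} (hr : 0 ≤ r) (hμr : μ ∉ closedBall c r)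
    (hμr' : μ ∈ ball c r') (hs : sphere c r ⊆ resolventSet ℂ T)
    (hs' : sphere c r' ⊆ resolventSet ℂ T) :
    (rieszProjection T c r' - rieszProjection T c r) v = v := by
  rw [sub_apply, rieszProjection_apply_of_apply_eq_smul hv hμr' hs',
    rieszProjection_apply_of_apply_eq_smul_of_not_mem hv hr hμr hs, sub_zero]

/-- `(P_{r'} − P_r) v = 0` for an eigenvector with eigenvalue in the inner disc `|μ − c| < r ≤ r'`.
[cite: Kato1966, III-§6.4 Thm. 6.17 (6.19) and III-§6.5] -/
theorem sub_rieszProjection_apply_of_mem_ball {T : E →L[ℂ] E} {μ : ℂ} {v : E}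
    (hv : T v = μ • v) {c : ℂ} {r r' : ℝ} (hrr' : r ≤ r') (hμ : μ ∈ ball c r)
    (hs : sphere c r ⊆ resolventSet ℂ T) (hs' : sphere c r' ⊆ resolventSet ℂ T) :
    (rieszProjection T c r' - rieszProjection T c r) v = 0 := by
  rw [sub_apply,
    rieszProjection_apply_of_apply_eq_smul hv (ball_subset_ball hrr' hμ) hs',
    rieszProjection_apply_of_apply_eq_smul hv hμ hs, sub_self]

/-- `(P_{r'} − P_r) v = 0` for an eigenvector with eigenvalue outside the outer closed disc.
[cite: Kato1966, III-§6.4 Thm. 6.17 (6.19) and III-§6.5] -/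
theorem sub_rieszProjection_apply_of_not_mem_closedBall {T : E →L[ℂ] E} {μ : ℂ} {v : E}
    (hv : T v = μ • v) {c : ℂ} {r r' : ℝ} (hr : 0 ≤ r) (hrr' : r ≤ r') (hμ : μ ∉ closedBall c r')
    (hs : sphere c r ⊆ resolventSet ℂ T) (hs' : sphere c r' ⊆ resolventSet ℂ T) :
    (rieszProjection T c r' - rieszProjection T c r) v = 0 := by
  have hμr : μ ∉ closedBall c r := fun h => hμ (closedBall_subset_closedBall hrr' h)
  rw [sub_apply,
    rieszProjection_apply_of_apply_eq_smul_of_not_mem hv (hr.trans hrr') hμ hs',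
    rieszProjection_apply_of_apply_eq_smul_of_not_mem hv hr hμr hs, sub_self]

/-- `(1 − P_r) v = v` for an eigenvector with eigenvalue outside the closed disc.
[cite: Kato1966, III-§6.4 Thm. 6.17 (6.19) and III-§6.5] -/
theorem one_sub_rieszProjection_apply_of_not_mem_closedBall {T : E →L[ℂ] E} {μ : ℂ} {v : E}
    (hv : T v = μ • v) {c : ℂ} {r : ℝ} (hr : 0 ≤ r) (hμ : μ ∉ closedBall c r)
    (hs : sphere c r ⊆ resolventSet ℂ T) : (1 - rieszProjection T c r) v = v := by
  rw [sub_apply, one_apply_eq_self,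
    rieszProjection_apply_of_apply_eq_smul_of_not_mem hv hr hμ hs, sub_zero]

/-- `(1 − P_r) v = 0` for an eigenvector with eigenvalue inside the circle.
[cite: Kato1966, III-§6.4 Thm. 6.17 (6.19) and III-§6.5] -/
theorem one_sub_rieszProjection_apply_of_mem_ball {T : E →L[ℂ] E} {μ : ℂ} {v : E}
    (hv : T v = μ • v) {c : ℂ} {r : ℝ} (hμ : μ ∈ ball c r) (hs : sphere c r ⊆ resolventSet ℂ T) :
    (1 - rieszProjection T c r) v = 0 := by
  rw [sub_apply, one_apply_eq_self,
    rieszProjection_apply_of_apply_eq_smul hv hμ hs, sub_self]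

omit [CompleteSpace E] in
/-- **Identification of the scalar on a spectral subspace**: if `T Q = μ Q` for an operator `Q`
fixing a non-zero eigenvector `v` of `T` with eigenvalue `ν` (`Q v = v`), then `μ = ν`. With
`Q` an annulus or complementary projection and the lemmas above this identifies the value at the
base point of the holomorphic eigenvalue branches of `TwoDominantEigenvalues.lean`
(Kato III-§6.5). [cite: Kato1966, III-§6.5] -/
theorem eq_of_mul_eq_smul_of_apply_eq_self {T Q : E →L[ℂ] E} {μ ν : ℂ} {v : E} (hv : T v = ν • v)
    (hv0 : v ≠ 0) (hQv : Q v = v) (h : T * Q = μ • Q) : μ = ν := by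
  have h1 := congrArg (fun S : E →L[ℂ] E => S v) h
  simp only [mul_apply_eq_comp, smul_apply, hQv, hv] at h1
  have h2 : (ν - μ) • v = 0 := by rw [sub_smul, h1, sub_self]
  exact (sub_eq_zero.1 ((smul_eq_zero.1 h2).resolve_right hv0)).symm

end Operator

/-! ### Operators with an orthonormal eigenbasis: the rank of the annulus projection -/

section Hilbert

variable {H : Type*} [NormedAddCommGroup H] [InnerProductSpace ℂ H] [CompleteSpace H]
variable {ι : Type*} {e : HilbertBasis ι ℂ H} {T : H →L[ℂ] H} {κ : ι → ℂ}

/-- `(P_{r'} − P_r) eᵢ = eᵢ` when `κᵢ` lies in the open annulus (for a basis vector the annulus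
may be described by the open discs: `κᵢ ∉ ball c r`, `κᵢ ∈ ball c r'`). [cite: Kato1966, III-§6.5] -/
theorem sub_rieszProjection_apply_hilbertBasis_of_mem (hT : ∀ i, T (e i) = κ i • e i) {c : ℂ}
    {r r' : ℝ} (hr : 0 ≤ r) (hs : sphere c r ⊆ resolventSet ℂ T)
    (hs' : sphere c r' ⊆ resolventSet ℂ T) {i : ι} (hir : κ i ∉ ball c r) (hir' : κ i ∈ ball c r') :
    (rieszProjection T c r' - rieszProjection T c r) (e i) = e i := by
  rw [sub_apply, rieszProjection_apply_hilbertBasis_of_mem hT hs' hir',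
    rieszProjection_apply_hilbertBasis_of_not_mem hT hr hs hir, sub_zero]

/-- `(P_{r'} − P_r) eᵢ = 0` when `κᵢ` is not in the annulus (`r ≤ r'`). [cite: Kato1966, III-§6.5] -/
theorem sub_rieszProjection_apply_hilbertBasis_of_not_mem (hT : ∀ i, T (e i) = κ i • e i)
    {c : ℂ} {r r' : ℝ} (hr : 0 ≤ r) (hrr' : r ≤ r') (hs : sphere c r ⊆ resolventSet ℂ T)
    (hs' : sphere c r' ⊆ resolventSet ℂ T) {i : ι} (hi : ¬ (κ i ∉ ball c r ∧ κ i ∈ ball c r')) :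
    (rieszProjection T c r' - rieszProjection T c r) (e i) = 0 := by
  by_cases hir : κ i ∈ ball c r
  · rw [sub_apply,
      rieszProjection_apply_hilbertBasis_of_mem hT hs' (ball_subset_ball hrr' hir),
      rieszProjection_apply_hilbertBasis_of_mem hT hs hir, sub_self]
  · have hir' : κ i ∉ ball c r' := fun h => hi ⟨hir, h⟩
    rw [sub_apply,
      rieszProjection_apply_hilbertBasis_of_not_mem hT (hr.trans hrr') hs' hir',
      rieszProjection_apply_hilbertBasis_of_not_mem hT hr hs hir, sub_self]

/-- **`(P_{r'} − P_r) x = Σ_{i∈I} ⟨eᵢ, x⟩ eᵢ`** when exactly the indices in the finite set `I`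
have their eigenvalue in the annulus: the annulus projection is the orthogonal projection onto
`span {eᵢ : i ∈ I}` (Kato III-§6.5 / V-(3.22)). [cite: Kato1966, III-§6.5 and V-§3.5 (3.22)] -/
theorem sub_rieszProjection_apply_eq_sum (hT : ∀ i, T (e i) = κ i • e i) {c : ℂ} {r r' : ℝ}
    (hr : 0 ≤ r) (hrr' : r ≤ r') (hs : sphere c r ⊆ resolventSet ℂ T)
    (hs' : sphere c r' ⊆ resolventSet ℂ T) (I : Finset ι)
    (hI : ∀ i, (κ i ∉ ball c r ∧ κ i ∈ ball c r') ↔ i ∈ I) (x : H) :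
    (rieszProjection T c r' - rieszProjection T c r) x = ∑ i ∈ I, ⟪e i, x⟫_ℂ • e i :=
  clm_apply_eq_sum_of_apply_hilbertBasis e _ I
    (fun i hi => sub_rieszProjection_apply_hilbertBasis_of_mem hT hr hs hs' ((hI i).2 hi).1
      ((hI i).2 hi).2)
    (fun i hi => sub_rieszProjection_apply_hilbertBasis_of_not_mem hT hr hrr' hs hs'
      fun h => hi ((hI i).1 h)) x

/-- **The total multiplicity in the annulus**: `dim Ran (P_{r'} − P_r) = |I|`.
[cite: Kato1966, III-§6.5 and V-§3.5 (3.22)] -/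
theorem finrank_range_sub_rieszProjection_eq_card (hT : ∀ i, T (e i) = κ i • e i) {c : ℂ}
    {r r' : ℝ} (hr : 0 ≤ r) (hrr' : r ≤ r') (hs : sphere c r ⊆ resolventSet ℂ T)
    (hs' : sphere c r' ⊆ resolventSet ℂ T) (I : Finset ι)
    (hI : ∀ i, (κ i ∉ ball c r ∧ κ i ∈ ball c r') ↔ i ∈ I) :
    Module.finrank ℂ (LinearMap.range
      ((rieszProjection T c r' - rieszProjection T c r : H →L[ℂ] H) : H →ₗ[ℂ] H)) = I.card :=
  finrank_range_eq_card_of_apply_hilbertBasis e _ I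
    (fun i hi => sub_rieszProjection_apply_hilbertBasis_of_mem hT hr hs hs' ((hI i).2 hi).1
      ((hI i).2 hi).2)
    (fun i hi => sub_rieszProjection_apply_hilbertBasis_of_not_mem hT hr hrr' hs hs'
      fun h => hi ((hI i).1 h))

/-- The simple case: if `i₀` is the only index with `κᵢ` in the annulus then
`dim Ran (P_{r'} − P_r) = 1` — one simple eigenvalue in the annulus, the rank hypothesis of
`exists_two_dominant_eigenvalues_asymptotics`. [cite: Kato1966, III-§6.5] -/
theorem finrank_range_sub_rieszProjection_eq_one (hT : ∀ i, T (e i) = κ i • e i) {c : ℂ}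
    {r r' : ℝ} (hr : 0 ≤ r) (hrr' : r ≤ r') (hs : sphere c r ⊆ resolventSet ℂ T)
    (hs' : sphere c r' ⊆ resolventSet ℂ T) (i₀ : ι)
    (hI : ∀ i, (κ i ∉ ball c r ∧ κ i ∈ ball c r') ↔ i = i₀) :
    Module.finrank ℂ (LinearMap.range
      ((rieszProjection T c r' - rieszProjection T c r : H →L[ℂ] H) : H →ₗ[ℂ] H)) = 1 := by
  rw [finrank_range_sub_rieszProjection_eq_card hT hr hrr' hs hs' {i₀}
      (fun i => by rw [Finset.mem_singleton]; exact hI i), Finset.card_singleton]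

end Hilbert

end Literature.Analysis.OperatorTheory
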